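import Literature.MathematicalPhysics.QuantumFieldTheory.Balaban1983to89.B1Eq324BenfattoKernelSect5IdErrBounds
import Literature.MathematicalPhysics.QuantumFieldTheory.Balaban1983to89.B1Eq324BenfattoKernelSect5Identification
import Literature.MathematicalPhysics.QuantumFieldTheory.Balaban1983to89.B1Eq324BenfattoKernelSect5FreeStepCross
import Literature.MathematicalPhysics.QuantumFieldTheory.Balaban1983to89.B1Eq324BenfattoKernelSect5PerBoxAtPavement
import Literature.MathematicalPhysics.QuantumFieldTheory.Balaban1983to89.B1Eq324BenfattoSect5StepBound
import HarnessLib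

/-!
# `Balaban1983to89.B1Eq324BenfattoKernelSect5StepBound` — [BenfattoEtAl1978] §5 pp. 155–159: ONE PAVEMENT STEP OF THE CLASS ROAD, CUMULANT SIDE
# CLOSED — the four displayed correction terms of `…KernelSect5Identification`'s `idErr` replaced by the landed CLOSED bounds under `𝒩(0,K)`
# ((5.11), (5.24), (5.33)–(5.34), CROSS, Appendix D), and the per-step hypotheses `hbox` / `hE` of the class pavement chain produced as ONE
# existential statement per class member in standard position, from the cluster rows and the depth rows only

statement-level skeleton of published theorems with citation tags; proofs where landed; nothing here is a claim about the
Yang–Mills mass gap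

WHY THIS MODULE (cell `pub-ymgap`, seat `dag-n08-c` gen 31; node N08 [Balaban1985UV3]; the [BenfattoEtAl1978] source chain behind the (α)-row `h324`;
the ASSEMBLY layer over the class chain — structural S8 of `N08-PORT-MAP-STRUCTURAL-SIDE.md`, seat n08-d's `…KernelSect5PavementChain`).  The class lower
chain consumes, per step `k` at the frame-`k` class member, (hbox) per-box lower bounds with exponents `ℓ_k(□)` and — for the collection of errors
(`…Sect5CollectErrors.ineq47_of_chain`'s class twin) — (hE) `cumulantSum μ_K H_J t − cumulantSum μ_K H_{Γ̄₁} t − idErr ≤ Σ_□ℓ(□)`.  This file is the class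
edition of my concrete `…Sect5StepBound` (p577481): `hbox` from `…KernelSect5PerBoxAtPavement.hbox_of_clusterRows` (rows (a)–(f) displayed, masses discharged
by `…Sect5PerBoxAtPavement.mass_classes_le` / `weightedMass_classes_le`, (5.19)'s side condition by `card_shrink_mul_exp_le`), `hE` from
`…KernelSect5Identification.identification_lower` with the four `|·|` bounded by `…KernelSect5IdErrBounds` and seat n08-b's
`…KernelSect5FreeStepCross.abs_cross_kernel_le_closed` (p615732) at the palette of `…Sect5CrossPalette` (measure-free, BY NAME).  Token map of the concrete
proofs: `(hα, hβ, hd) ↦ (hK, hdiag, hK₀, hdec)`, `max 1 C₀₀ ↦ K₀`, `log((2d+α²)/2d) ↦ δ₀`, `P̂₀ ↦ 𝒩(0,K)`, `perBox_at_pavement ↦ hbox_of_clusterRows`.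

WHAT IS PROVED (theorems only; no definition, no named fact, no `sorry`; axioms standard).
* `cross_eq_paletteCross_kernel` (the CROSS sum over the palette FUNCTIONS = over the palette CLASSES, under `𝒩(0,K)`), ★★ `cumulantSide_le` (the four
  `|·|` summed with the `1/(k+1)!` weights `≤` the CLOSED cumulant-side bound, under `𝒩(0,K)` of the class kernel with rows `hdiag`/`hdec`),
  ★★★ `exists_lower_step` (∃ `ℓ Err`: hbox ∧ hE ∧ `Err = closed`, at one class member `(Λ, A, K)` in standard position with part kernels `Kb` and the
  depth rows (a)–(f) DISPLAYED — n08-w5's `…KernelSect5PartFieldRows` discharges them).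

HONEST SCOPE / NOT HERE.  The sum over the `d+1` steps (n08-d's class chain), the Appendix-A end and the ledger against `|I|·errTerm` are the sequel; the
depth rows stay displayed; one self-located piece of an UNCOMMISSIONED port (plan g81 (II), START-LIST v11 §n08) — nothing chained; no generalised
Basic Lemma is stated; nothing of [Balaban1985UV3] is asserted; count-neutral for N08; nothing about d = 4, the continuum, OS axioms, a mass gap or
the Clay problem.
-/

noncomputable section

open MeasureTheory ProbabilityTheory Finset Matrix
open scoped BigOperators Nat NNReal

namespace Literature.MathematicalPhysics.QuantumFieldTheory.Balaban1983to89.B1Eq324BenfattoKernelSect5StepBound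

open _root_.MeasureTheory _root_.ProbabilityTheory
open Literature.Probability.LatticeModels (setPartitions ursellOf cumulantOf)
open Literature.MathematicalPhysics.QuantumFieldTheory
open Literature.MathematicalPhysics.QuantumFieldTheory.Balaban1983to89.B1Eq324BenfattoLemma
open Literature.MathematicalPhysics.QuantumFieldTheory.Balaban1983to89.B1Eq324BenfattoSect5Boxes
open Literature.MathematicalPhysics.QuantumFieldTheory.Balaban1983to89.B1Eq324BenfattoSect5Eq511
open Literature.MathematicalPhysics.QuantumFieldTheory.Balaban1983to89.B1Eq324BenfattoSect5Eq524
open Literature.MathematicalPhysics.QuantumFieldTheory.Balaban1983to89.B1Eq324BenfattoSect5Eq534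
open Literature.MathematicalPhysics.QuantumFieldTheory.Balaban1983to89.B1Eq324BenfattoSect5Eq515
open Literature.MathematicalPhysics.QuantumFieldTheory.Balaban1983to89.B1Eq324BenfattoSect5Iteration (restrictCoef)
open Literature.MathematicalPhysics.QuantumFieldTheory.Balaban1983to89.B1Eq324BenfattoKernelOfPrecision (isPosSemidefKernel_kernel)
open Literature.MathematicalPhysics.QuantumFieldTheory.Balaban1983to89.B1Eq324BenfattoClassAppendixC (posDef_of_coercive)
open Literature.MathematicalPhysics.QuantumFieldTheory.Balaban1983to89.B1Eq324BenfattoSect5CrossPalette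
  (palette_deep palette_none palette_box palette_pairwiseDisjoint palette_eq_tupleSum)
open Literature.MathematicalPhysics.QuantumFieldTheory.Balaban1983to89.B1Eq324BenfattoSect5StepBound (shrink_nonempty)
open Literature.MathematicalPhysics.QuantumFieldTheory.Balaban1983to89.B1Eq324BenfattoSect5PerBoxAtPavement
  (mass_classes_le weightedMass_classes_le card_shrink_mul_exp_le)
open Literature.MathematicalPhysics.QuantumFieldTheory.Balaban1983to89.B1Eq324BenfattoKernelSect5IdErrBounds
  (abs_truncatedExp_hamiltonian_sub_X_le abs_truncatedExp_corridorsBar_sub_Y_le abs_sum_W29_le)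
open Literature.MathematicalPhysics.QuantumFieldTheory.Balaban1983to89.B1Eq324BenfattoKernelSect5FreeStepCross (abs_cross_kernel_le_closed)
open Literature.MathematicalPhysics.QuantumFieldTheory.Balaban1983to89.B1Eq324BenfattoKernelSect5PerBoxAtPavement (hbox_of_clusterRows)
open Literature.MathematicalPhysics.QuantumFieldTheory.Balaban1983to89.B1Eq324GaussianMomentLeaf (momentConst)

variable {d : ℕ}

/-! ## §1  The cumulant side of one step, closed, under `𝒩(0,K)` -/

section CumulantSide

variable {K : B1Eq324BenfattoLemma.Site d → B1Eq324BenfattoLemma.Site d → ℝ}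
  {s D : ℕ} {κ : ℝ} {a : Coef d} {J I : Finset (B1Eq324BenfattoLemma.Site d)} {L w v : ℕ}

/-- **The CROSS sum over the palette FUNCTIONS equals the CROSS sum over the palette CLASSES** (`…CrossPalette.palette_eq_tupleSum` under the integral).
[cite: BenfattoEtAl1978, (5.35) p.159] -/
theorem cross_eq_paletteCross_kernel (K : B1Eq324BenfattoLemma.Site d → B1Eq324BenfattoLemma.Site d → ℝ) (hJ : CoefSupportedIn a J) (hv : v ≤ w) (k : ℕ) :
    ∑ f ∈ univ.filter (fun f : Fin (k + 1) → Option (↥(J.image (boxIndex L)) × Bool) =>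
                  (∃ j m, f j = some (m, true)) ∧ ¬∃ m, ∀ j, f j = some (m, false) ∨ f j = some (m, true)),
                  ursellOf (fun P : Finset (Fin (k + 1)) => ∫ z, ∏ j ∈ P, (fun (c : Option (↥(J.image (boxIndex L)) × Bool)) (z : B1Eq324BenfattoLemma.Site d → ℝ) =>
        Option.elim c (hamiltonian s D κ a (corridors L w (J.image (boxIndex L))) z)
          (fun mb => bif mb.2 then psi1pp s D κ a L w v (mb.1 : B1Eq324BenfattoLemma.Site d) z
            else psi1p s D κ a L w v (mb.1 : B1Eq324BenfattoLemma.Site d) z + psi2 s D κ a L w (mb.1 : B1Eq324BenfattoLemma.Site d) z)) (f j) z ∂gaussianFieldOfKernel K) univ =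
      ∑ f ∈ univ.filter (fun f : Fin (k + 1) → Option (↥(J.image (boxIndex L)) × Bool) =>
          (∃ j m, f j = some (m, true)) ∧ ¬∃ m, ∀ j, f j = some (m, false) ∨ f j = some (m, true)),
        ursellOf (fun P : Finset (Fin (k + 1)) => ∫ z, ∏ j ∈ P,
          (∑ p ∈ Finset.Icc 1 s, ∑ Δ ∈ (fun (c : Option (↥(J.image (boxIndex L)) × Bool)) (p : ℕ) =>
        if p = 0 then (∅ : Finset (Fin p → J)) else
          Option.elim c (tuplesIn J p (corridors L w (J.image (boxIndex L))))
            (fun mb => bif mb.2 then ((tuplesIn J p (core L w (mb.1 : B1Eq324BenfattoLemma.Site d)) \ tuplesIn J p (frame4 L w v (mb.1 : B1Eq324BenfattoLemma.Site d))) ∪ (crossT J p (core L w (mb.1 : B1Eq324BenfattoLemma.Site d)) (frame3 L w v (mb.1 : B1Eq324BenfattoLemma.Site d)) \ crossT J p (frame4 L w v (mb.1 : B1Eq324BenfattoLemma.Site d)) (frame3 L w v (mb.1 : B1Eq324BenfattoLemma.Site d))))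
              else (tuplesIn J p (frame4 L w v (mb.1 : B1Eq324BenfattoLemma.Site d)) ∪ crossT J p (frame4 L w v (mb.1 : B1Eq324BenfattoLemma.Site d)) (frame3 L w v (mb.1 : B1Eq324BenfattoLemma.Site d))) ∪ (crossT J p (frame1 L w (mb.1 : B1Eq324BenfattoLemma.Site d)) (frame2 L w (mb.1 : B1Eq324BenfattoLemma.Site d)) ∪ tuplesIn J p (frame2 L w (mb.1 : B1Eq324BenfattoLemma.Site d))))) (f j) p, ∑ n ∈ admissible p D, term κ a z p Δ n) ∂gaussianFieldOfKernel K) univ := by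
  refine Finset.sum_congr rfl fun f _ => ?_
  congr 1
  funext P
  refine integral_congr_ae (ae_of_all _ fun z => ?_)
  exact Finset.prod_congr rfl fun j _ => palette_eq_tupleSum (s := s) (D := D) (κ := κ) hJ hv (f j) z

/-- **THE CUMULANT SIDE OF ONE STEP, CLOSED**: for the boxes `B = J.image boxIndex` of the standard pavement (`A` supported in `J`, global bound `A`, `L > 2(2w+v)`,
`v ≤ w`, a rate `0 < δ ≤ log((2d+α²)/2d)` with `ϰ/2 > (δ/2)D²√d`), the four displayed terms of `…Identification`'s `idErr`, summed with the weights `1/(k+1)!`,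
are at most the CLOSED sum of: (5.11)-in-cumulants + `Ψ₃`-removal (`…IdErrBounds.abs_truncatedExp_hamiltonian_sub_X_le`), (5.34)-remainder + (5.33)-correction
(`…abs_truncatedExp_corridorsBar_sub_Y_le`), CROSS (`…FreeStepCrossBound.abs_cross_le_closed` at the palette of `…CrossPalette`), and the within-box colourings
(`…abs_sum_W29_le`). [cite: BenfattoEtAl1978, (5.11) p.155, (5.24)–(5.29) p.157, (5.33)–(5.35) p.159] -/
theorem cumulantSide_le (hK : IsPosSemidefKernel K) {c₀ : ℝ≥0} (hdiag : ∀ y, K y y ≤ c₀)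
    {K₀ δ₀ : ℝ} (hK₀ : 1 ≤ K₀)
    (hdec : ∀ x y : B1Eq324BenfattoLemma.Site d, |K x y| ≤ K₀ * Real.exp (-(δ₀ * ∑ jj, |((x jj : ℝ) - (y jj : ℝ))|)))
    (hJ : CoefSupportedIn a J) {A : ℝ} (hA0 : 0 ≤ A)
    (hA : ∀ (p : ℕ) (Δ : Fin p → B1Eq324BenfattoLemma.Site d) (n : Fin p → ℕ), |a p Δ n| ≤ A)
    (hL : 0 < L) (hL2 : 2 * (2 * w + v) < L) (hv : v ≤ w) {δ : ℝ} (hδ : 0 < δ) (hδle : δ ≤ δ₀)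
    (hres : 0 < κ / 2 - δ / 2 * ((D : ℝ) ^ 2 * Real.sqrt d)) (t : ℕ) :
    ∑ k ∈ Finset.range t,
            (|truncatedExp (gaussianFieldOfKernel K) (hamiltonian s D κ a J) (k + 1) - truncatedExp (gaussianFieldOfKernel K) (fun z => hamiltonian s D κ a (corridors L w (J.image (boxIndex L))) z + ∑ m ∈ (J.image (boxIndex L)), (psi1 s D κ a L w v m z + psi2 s D κ a L w m z)) (k + 1)|
              + |truncatedExp (gaussianFieldOfKernel K) (hamiltonian s D κ a (corridorsBar L w v (J.image (boxIndex L)))) (k + 1) - truncatedExp (gaussianFieldOfKernel K) (fun z => hamiltonian s D κ a (corridors L w (J.image (boxIndex L))) z + ∑ m ∈ (J.image (boxIndex L)), (psi1p s D κ a L w v m z + psi2 s D κ a L w m z)) (k + 1)|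
              + |∑ f ∈ univ.filter (fun f : Fin (k + 1) → Option (↥(J.image (boxIndex L)) × Bool) =>
                  (∃ j m, f j = some (m, true)) ∧ ¬∃ m, ∀ j, f j = some (m, false) ∨ f j = some (m, true)),
                  ursellOf (fun P : Finset (Fin (k + 1)) => ∫ z, ∏ j ∈ P, (fun (c : Option (↥(J.image (boxIndex L)) × Bool)) (z : B1Eq324BenfattoLemma.Site d → ℝ) =>
        Option.elim c (hamiltonian s D κ a (corridors L w (J.image (boxIndex L))) z)
          (fun mb => bif mb.2 then psi1pp s D κ a L w v (mb.1 : B1Eq324BenfattoLemma.Site d) z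
            else psi1p s D κ a L w v (mb.1 : B1Eq324BenfattoLemma.Site d) z + psi2 s D κ a L w (mb.1 : B1Eq324BenfattoLemma.Site d) z)) (f j) z ∂gaussianFieldOfKernel K) univ|
              + |∑ m ∈ (J.image (boxIndex L)), ∑ f ∈ univ.filter (fun f : Fin (k + 1) → Fin 3 => (∃ j, f j = 1) ∧ ∃ j, f j = 2),
                  ursellOf (fun P : Finset (Fin (k + 1)) => ∫ z, ∏ j ∈ P,
                    (![fun z => psi1p s D κ a L w v m z, fun z => psi1pp s D κ a L w v m z, fun z => psi2 s D κ a L w m z] (f j)) z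
                      ∂gaussianFieldOfKernel K) univ|) / (k + 1)! ≤
      ∑ k ∈ Finset.range t,
          ((2 ^ (k + 1) * (2 ^ ((k + 1) * D) * 2 ^ 2 ^ ((k + 1) * D) * K₀ ^ ((k + 1) * D)) *
          ((A * Real.exp (δ / 2 * ((D : ℝ) ^ 2 * d)) *
              Real.exp (-((κ / 2 - δ / 2 * ((D : ℝ) ^ 2 * Real.sqrt d)) / 2 * w))) * J.card *
            ∑ p ∈ Finset.Icc 1 s, ((admissible p D).card : ℝ) *
              ((2 / (1 - Real.exp (-((κ / 2 - δ / 2 * ((D : ℝ) ^ 2 * Real.sqrt d)) / 2 / (p : ℕ) / Real.sqrt d))) *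
                Real.exp ((κ / 2 - δ / 2 * ((D : ℝ) ^ 2 * Real.sqrt d)) / 2 / (p : ℕ) / Real.sqrt d)) ^ d) ^ (p - 1)) *
          (A * Real.exp (δ / 2 * ((D : ℝ) ^ 2 * d)) *
            ((1 : ℝ) * (2 / (1 - Real.exp (-(δ / (2 * ((k + 1 : ℕ) : ℝ)) / Real.sqrt d))) * Real.exp (δ / (2 * ((k + 1 : ℕ) : ℝ)) / Real.sqrt d)) ^ d) *
            ∑ p ∈ Finset.Icc 1 s, ((admissible p D).card : ℝ) *
              ((2 / (1 - Real.exp (-((κ / 2 - δ / 2 * ((D : ℝ) ^ 2 * Real.sqrt d)) / (p : ℕ) / Real.sqrt d))) *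
                Real.exp ((κ / 2 - δ / 2 * ((D : ℝ) ^ 2 * Real.sqrt d)) / (p : ℕ) / Real.sqrt d)) ^ d) ^ (p - 1)) ^ k
          + 2 ^ (k + 1) * (2 ^ ((k + 1) * D) * 2 ^ 2 ^ ((k + 1) * D) * K₀ ^ ((k + 1) * D)) *
        ((J.image (boxIndex L)).card * (A * Real.exp (δ / 2 * ((D : ℝ) ^ 2 * d)) * Real.exp (-((κ / 2 - δ / 2 * ((D : ℝ) ^ 2 * Real.sqrt d)) / 2 * v)) *
          (L : ℝ) ^ d * ∑ p ∈ Finset.Icc 1 s, ((admissible p D).card : ℝ) *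
              ((2 / (1 - Real.exp (-((κ / 2 - δ / 2 * ((D : ℝ) ^ 2 * Real.sqrt d)) / 2 / (p : ℕ) / Real.sqrt d))) *
                Real.exp ((κ / 2 - δ / 2 * ((D : ℝ) ^ 2 * Real.sqrt d)) / 2 / (p : ℕ) / Real.sqrt d)) ^ d) ^ (p - 1))) *
        (A * Real.exp (δ / 2 * ((D : ℝ) ^ 2 * d)) *
          (2 / (1 - Real.exp (-(δ / (2 * ((k + 1 : ℕ) : ℝ)) / Real.sqrt d))) * Real.exp (δ / (2 * ((k + 1 : ℕ) : ℝ)) / Real.sqrt d)) ^ d *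
          ∑ p ∈ Finset.Icc 1 s, ((admissible p D).card : ℝ) *
              ((2 / (1 - Real.exp (-((κ / 2 - δ / 2 * ((D : ℝ) ^ 2 * Real.sqrt d)) / (p : ℕ) / Real.sqrt d))) *
                Real.exp ((κ / 2 - δ / 2 * ((D : ℝ) ^ 2 * Real.sqrt d)) / (p : ℕ) / Real.sqrt d)) ^ d) ^ (p - 1)) ^ k)
          + (2 ^ (k + 1) * (2 ^ ((k + 1) * D) * 2 ^ 2 ^ ((k + 1) * D) * K₀ ^ ((k + 1) * D)) *
          (A * Real.exp (δ / 2 * ((D : ℝ) ^ 2 * d)) * Real.exp (-((κ / 2 - δ / 2 * ((D : ℝ) ^ 2 * Real.sqrt d)) / 2 * w)) *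
            (corridorsBar L w v (J.image (boxIndex L))).card * ∑ p ∈ Finset.Icc 1 s, ((admissible p D).card : ℝ) *
              ((2 / (1 - Real.exp (-((κ / 2 - δ / 2 * ((D : ℝ) ^ 2 * Real.sqrt d)) / 2 / (p : ℕ) / Real.sqrt d))) *
                Real.exp ((κ / 2 - δ / 2 * ((D : ℝ) ^ 2 * Real.sqrt d)) / 2 / (p : ℕ) / Real.sqrt d)) ^ d) ^ (p - 1)) *
          (A * Real.exp (δ / 2 * ((D : ℝ) ^ 2 * d)) *
            (2 / (1 - Real.exp (-(δ / (2 * ((k + 1 : ℕ) : ℝ)) / Real.sqrt d))) * Real.exp (δ / (2 * ((k + 1 : ℕ) : ℝ)) / Real.sqrt d)) ^ d *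
            ∑ p ∈ Finset.Icc 1 s, ((admissible p D).card : ℝ) *
              ((2 / (1 - Real.exp (-((κ / 2 - δ / 2 * ((D : ℝ) ^ 2 * Real.sqrt d)) / (p : ℕ) / Real.sqrt d))) *
                Real.exp ((κ / 2 - δ / 2 * ((D : ℝ) ^ 2 * Real.sqrt d)) / (p : ℕ) / Real.sqrt d)) ^ d) ^ (p - 1)) ^ k
          + 2 ^ (k + 1) * (2 ^ ((k + 1) * D) * 2 ^ 2 ^ ((k + 1) * D) * K₀ ^ ((k + 1) * D)) *
        ((J.image (boxIndex L)).card * (A * Real.exp (δ / 2 * ((D : ℝ) ^ 2 * d)) * Real.exp (-((κ / 2 - δ / 2 * ((D : ℝ) ^ 2 * Real.sqrt d)) / 2 * v)) *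
          (L : ℝ) ^ d * ∑ p ∈ Finset.Icc 1 s, ((admissible p D).card : ℝ) *
              ((2 / (1 - Real.exp (-((κ / 2 - δ / 2 * ((D : ℝ) ^ 2 * Real.sqrt d)) / 2 / (p : ℕ) / Real.sqrt d))) *
                Real.exp ((κ / 2 - δ / 2 * ((D : ℝ) ^ 2 * Real.sqrt d)) / 2 / (p : ℕ) / Real.sqrt d)) ^ d) ^ (p - 1))) *
        (A * Real.exp (δ / 2 * ((D : ℝ) ^ 2 * d)) *
          (2 / (1 - Real.exp (-(δ / (2 * ((k + 1 : ℕ) : ℝ)) / Real.sqrt d))) * Real.exp (δ / (2 * ((k + 1 : ℕ) : ℝ)) / Real.sqrt d)) ^ d *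
          ∑ p ∈ Finset.Icc 1 s, ((admissible p D).card : ℝ) *
              ((2 / (1 - Real.exp (-((κ / 2 - δ / 2 * ((D : ℝ) ^ 2 * Real.sqrt d)) / (p : ℕ) / Real.sqrt d))) *
                Real.exp ((κ / 2 - δ / 2 * ((D : ℝ) ^ 2 * Real.sqrt d)) / (p : ℕ) / Real.sqrt d)) ^ d) ^ (p - 1)) ^ k)
          + 2 ^ ((k + 1) * D) * 2 ^ 2 ^ ((k + 1) * D) * K₀ ^ ((k + 1) * D) *
        ((J.image (boxIndex L)).card * (((k + 1 : ℕ) : ℝ) * (k : ℝ) *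
          ((A * Real.exp (δ / 2 * ((D : ℝ) ^ 2 * d)) * ((L : ℝ) ^ d * (2 / (1 - Real.exp (-(δ / (2 * ((k + 1 : ℕ) : ℝ)) / Real.sqrt d))) * Real.exp (δ / (2 * ((k + 1 : ℕ) : ℝ)) / Real.sqrt d)) ^ d) *
              ∑ p ∈ Finset.Icc 1 s, ((admissible p D).card : ℝ) *
              ((2 / (1 - Real.exp (-((κ / 2 - δ / 2 * ((D : ℝ) ^ 2 * Real.sqrt d)) / (p : ℕ) / Real.sqrt d))) *
                Real.exp ((κ / 2 - δ / 2 * ((D : ℝ) ^ 2 * Real.sqrt d)) / (p : ℕ) / Real.sqrt d)) ^ d) ^ (p - 1)) * ((A * Real.exp (δ / 2 * ((D : ℝ) ^ 2 * d)) * Real.exp (-(δ / (2 * ((k + 1 : ℕ) : ℝ)) / 2 * ((w : ℝ) + v + 1))) * ((L : ℝ) ^ d * (2 / (1 - Real.exp (-(δ / (2 * ((k + 1 : ℕ) : ℝ)) / 2 / Real.sqrt d))) * Real.exp (δ / (2 * ((k + 1 : ℕ) : ℝ)) / 2 / Real.sqrt d)) ^ d) *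
              ∑ p ∈ Finset.Icc 1 s, ((admissible p D).card : ℝ) *
              ((2 / (1 - Real.exp (-((κ / 2 - δ / 2 * ((D : ℝ) ^ 2 * Real.sqrt d)) / (p : ℕ) / Real.sqrt d))) *
                Real.exp ((κ / 2 - δ / 2 * ((D : ℝ) ^ 2 * Real.sqrt d)) / (p : ℕ) / Real.sqrt d)) ^ d) ^ (p - 1)) *
             (A * Real.exp (δ / 2 * ((D : ℝ) ^ 2 * d)) * ((L : ℝ) ^ d * (2 / (1 - Real.exp (-(δ / (2 * ((k + 1 : ℕ) : ℝ)) / Real.sqrt d))) * Real.exp (δ / (2 * ((k + 1 : ℕ) : ℝ)) / Real.sqrt d)) ^ d) *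
              ∑ p ∈ Finset.Icc 1 s, ((admissible p D).card : ℝ) *
              ((2 / (1 - Real.exp (-((κ / 2 - δ / 2 * ((D : ℝ) ^ 2 * Real.sqrt d)) / (p : ℕ) / Real.sqrt d))) *
                Real.exp ((κ / 2 - δ / 2 * ((D : ℝ) ^ 2 * Real.sqrt d)) / (p : ℕ) / Real.sqrt d)) ^ d) ^ (p - 1)) ^ (k - 1)))))
          + (J.image (boxIndex L)).card * ((3 : ℝ) ^ (k + 1) *
        (2 ^ ((k + 1) * D) * 2 ^ 2 ^ ((k + 1) * D) * K₀ ^ ((k + 1) * D) *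
            Real.exp (-(δ / 2 * ((v : ℝ) + 1))) *
          (A * Real.exp (δ / 2 * ((D : ℝ) ^ 2 * d)) * (L : ℝ) ^ d * ∑ p ∈ Finset.Icc 1 s, ((admissible p D).card : ℝ) *
              ((2 / (1 - Real.exp (-((κ / 2 - δ / 2 * ((D : ℝ) ^ 2 * Real.sqrt d)) / (p : ℕ) / Real.sqrt d))) *
                Real.exp ((κ / 2 - δ / 2 * ((D : ℝ) ^ 2 * Real.sqrt d)) / (p : ℕ) / Real.sqrt d)) ^ d) ^ (p - 1)) ^ (k + 1)))) / (k + 1)! := by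
  refine Finset.sum_le_sum fun k _ => ?_
  have hfac : (0 : ℝ) < (k + 1)! := by exact_mod_cast Nat.factorial_pos (k + 1)
  refine div_le_div_of_nonneg_right ?_ hfac.le
  have ha := abs_truncatedExp_hamiltonian_sub_X_le (s := s) (D := D) (κ := κ) (B := (J.image (boxIndex L))) hK hdiag hK₀ hdec hJ hA0 hA hL subset_rfl hv hδ hδle hres k
  have hb := abs_truncatedExp_corridorsBar_sub_Y_le (s := s) (D := D) (κ := κ) (B := (J.image (boxIndex L))) hK hdiag hK₀ hdec hJ hA0 hA hL hv hδ hδle hres k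
  have hW := abs_sum_W29_le (s := s) (D := D) (κ := κ) (L := L) (B := (J.image (boxIndex L))) hK hdiag hK₀ hdec hJ hA0 hA hv hδ.le hδle hres k
  have hc := abs_cross_kernel_le_closed (s := s) (D := D) (κ := κ) (J := J) (L := L) (w := w) (v := v) (B := (J.image (boxIndex L))) hK hdiag hK₀ hdec hL hres hδ hδle hA0 hA
    (fun m => shrink_nonempty hL2 _) (fun (c : Option (↥(J.image (boxIndex L)) × Bool)) (p : ℕ) =>
        if p = 0 then (∅ : Finset (Fin p → J)) else
          Option.elim c (tuplesIn J p (corridors L w (J.image (boxIndex L))))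
            (fun mb => bif mb.2 then ((tuplesIn J p (core L w (mb.1 : B1Eq324BenfattoLemma.Site d)) \ tuplesIn J p (frame4 L w v (mb.1 : B1Eq324BenfattoLemma.Site d))) ∪ (crossT J p (core L w (mb.1 : B1Eq324BenfattoLemma.Site d)) (frame3 L w v (mb.1 : B1Eq324BenfattoLemma.Site d)) \ crossT J p (frame4 L w v (mb.1 : B1Eq324BenfattoLemma.Site d)) (frame3 L w v (mb.1 : B1Eq324BenfattoLemma.Site d))))
              else (tuplesIn J p (frame4 L w v (mb.1 : B1Eq324BenfattoLemma.Site d)) ∪ crossT J p (frame4 L w v (mb.1 : B1Eq324BenfattoLemma.Site d)) (frame3 L w v (mb.1 : B1Eq324BenfattoLemma.Site d))) ∪ (crossT J p (frame1 L w (mb.1 : B1Eq324BenfattoLemma.Site d)) (frame2 L w (mb.1 : B1Eq324BenfattoLemma.Site d)) ∪ tuplesIn J p (frame2 L w (mb.1 : B1Eq324BenfattoLemma.Site d)))))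
    palette_deep palette_none (palette_box hv) (palette_pairwiseDisjoint hL hv) k
  rw [← cross_eq_paletteCross_kernel (s := s) (D := D) (κ := κ) K hJ hv k] at hc
  linarith


end CumulantSide

/-! ## §2  One lower step of the class road, packaged for the chain -/

section Step

variable {Λ : Finset (B1Eq324BenfattoLemma.Site d)} {A : Matrix Λ Λ ℝ}
  {K : B1Eq324BenfattoLemma.Site d → B1Eq324BenfattoLemma.Site d → ℝ}
  (hK : ∀ x y, K x y = if h : x ∈ Λ ∧ y ∈ Λ then (A⁻¹ : Matrix Λ Λ ℝ) ⟨x, h.1⟩ ⟨y, h.2⟩ else 0)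
  {s D : ℕ} {κ : ℝ} {a : Coef d} {J I : Finset (B1Eq324BenfattoLemma.Site d)} {L w v : ℕ}
  {γ b Ac : ℝ}
  (hAs : ∀ e e', A e e' = A e' e) {γA : ℝ} (hγA0 : 0 < γA)
  (hγA : ∀ x : Λ → ℝ, γA * ∑ e, x e ^ 2 ≤ ∑ e, ∑ e', A e e' * x e * x e')
  (hΓΛ : corridors L w (J.image (boxIndex L)) ⊆ Λ) (hBΛ : ∀ m ∈ (J.image (boxIndex L)), box L m ⊆ Λ)
  {Kb : B1Eq324BenfattoLemma.Site d → B1Eq324BenfattoLemma.Site d → B1Eq324BenfattoLemma.Site d → ℝ}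
  (hKb : ∀ m (hm : m ∈ (J.image (boxIndex L))) x y, Kb m x y = if h : x ∈ shrink L m w ∧ y ∈ shrink L m w then
    ((A.submatrix (fun j : ↥(shrink L m w) => (⟨j, hBΛ m hm (shrink_subset_box L m w j.2)⟩ : Λ))
      (fun j : ↥(shrink L m w) => (⟨j, hBΛ m hm (shrink_subset_box L m w j.2)⟩ : Λ)))⁻¹ :
        Matrix ↥(shrink L m w) ↥(shrink L m w) ℝ) ⟨x, h.1⟩ ⟨y, h.2⟩ else 0)

include hK hAs hγA0 hγA hΓΛ hKb

/-- **ONE LOWER STEP OF THE CLASS ROAD, PACKAGED FOR THE CHAIN** — at a class member `(Λ, A, K)` carrying a standard-position datum `(J ⊆ I, a, b)` with the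
boxes `B = J.image boxIndex`, part kernels `Kb` (rows `hKb`), and the DISPLAYED depth rows (a) `|Kb m|, |K| ≤ K₀`, (b) decay of `Kb m` and of `K` at rate
`δ₀` in `ℓ¹`, (c) `|u_{Γ₁}(ξ)| ≤ Kᵤ` on `I`, (d)/(e) `|u_{Γ₁}(ξ)(x)|, |Kb m(x,y) − K(x,y)| ≤ ε₃₁` at depth, (f) `Kb m(x,x) ≤ ½`, `|u_{Γ₁}(ξ)(x)| ≤ ½b(1+d(Δ_x,I))` on
`□′∪Γ₂(□)` (`…KernelSect5PartFieldRows`, seat n08-w5, discharges them), there are per-box exponents `ℓ(□)` and errors `Err(□)` (a CLOSED expression, third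
conjunct) with: (hbox) `e^{ℓ(□)}·∫_{χ^□_b}e^{Ψ′₁+Ψ₂}dN^K_{□,ξ} ≤ ∫_{χ^□_b}e^{Ψ_□}dN^K_{□,ξ}` for every `□ ∈ B` and every `ξ` small on `Γ₁` at `γb`
(`…KernelSect5PerBoxAtPavement.hbox_of_clusterRows`); (hE) `cumulantSum μ_K H_J t − cumulantSum μ_K H_{Γ̄₁} t − (Σ_□Err(□) + [closed cumulant-side bound of
`cumulantSide_le`]) ≤ Σ_□ℓ(□)` (`…KernelSect5Identification.identification_lower`).  The class twin of `…Sect5StepBound.exists_lower_step`.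
[cite: BenfattoEtAl1978, (5.16)–(5.35) pp.155–159, (4.7) p.152] -/
theorem exists_lower_step (hκ : 0 < κ) (hJ : CoefSupportedIn a J) (hJI : J ⊆ I) (hAc0 : 0 ≤ Ac)
    (hA : ∀ (p : ℕ) (Δ : Fin p → B1Eq324BenfattoLemma.Site d) (n : Fin p → ℕ), |a p Δ n| ≤ Ac)
    (hL2 : 2 * (2 * w + v) < L) (hv : v ≤ w) (hb : 1 ≤ b) (hγ1 : γ ≤ 1)
    (hsmall : ((L : ℝ) ^ d) * Real.exp (-(b ^ 2 / 4)) ≤ 1 / 6)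
    {Ku K₀ δ₀ ε₃₁ : ℝ} (hKu : 0 ≤ Ku) (hKuK : Ku ≤ K₀) (hK₀1 : 1 ≤ K₀) (hε₃₁ : 0 ≤ ε₃₁)
    (huI : ∀ ξ ∈ smallFieldOn (corridors L w (J.image (boxIndex L)) : Set (B1Eq324BenfattoLemma.Site d)) I (γ * b),
      ∀ y ∈ I, |condMean K (corridors L w (J.image (boxIndex L))) ξ y| ≤ Ku)
    (hKR : ∀ m ∈ (J.image (boxIndex L)), ∀ x y, |Kb m x y| ≤ K₀) (hKrR : ∀ x y, |K x y| ≤ K₀)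
    (hKdec : ∀ x y : B1Eq324BenfattoLemma.Site d, |K x y| ≤ K₀ * Real.exp (-(δ₀ * ∑ jj, |((x jj : ℝ) - (y jj : ℝ))|)))
    (hdec : ∀ m ∈ (J.image (boxIndex L)), ∀ x y : B1Eq324BenfattoLemma.Site d,
      |Kb m x y| ≤ K₀ * Real.exp (-(δ₀ * ∑ jj, |((x jj : ℝ) - (y jj : ℝ))|)))
    (huε : ∀ m ∈ (J.image (boxIndex L)), ∀ ξ ∈ smallFieldOn (corridors L w (J.image (boxIndex L)) : Set (B1Eq324BenfattoLemma.Site d)) I (γ * b),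
      ∀ x ∈ shrink L m (w + (w - v)), |condMean K (corridors L w (J.image (boxIndex L))) ξ x| ≤ ε₃₁)
    (hKε : ∀ m ∈ (J.image (boxIndex L)), ∀ x ∈ shrink L m (w + (w - v)), ∀ y, |Kb m x y - K x y| ≤ ε₃₁)
    (hvar : ∀ m ∈ (J.image (boxIndex L)), ∀ x ∈ shrink L m w, Kb m x x ≤ 1 / 2)
    (hm : ∀ m ∈ (J.image (boxIndex L)), ∀ ξ ∈ smallFieldOn (corridors L w (J.image (boxIndex L)) : Set (B1Eq324BenfattoLemma.Site d)) I (γ * b),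
      ∀ x ∈ shrink L m w, |condMean K (corridors L w (J.image (boxIndex L))) ξ x| ≤ 1 / 2 * b * (1 + distToRegion I x))
    {δ : ℝ} (hδ : 0 < δ) (hδle : δ ≤ δ₀) (hres : 0 < κ / 2 - δ / 2 * ((D : ℝ) ^ 2 * Real.sqrt d)) (t : ℕ) :
    ∃ ℓ Err : B1Eq324BenfattoLemma.Site d → ℝ,
      (∀ m ∈ (J.image (boxIndex L)), ∀ ξ : B1Eq324BenfattoLemma.Site d → ℝ,
        ξ ∈ smallFieldOn (corridors L w (J.image (boxIndex L)) : Set (B1Eq324BenfattoLemma.Site d)) I (γ * b) →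
        Real.exp (ℓ m) * ∫ z in smallFieldOn (shrink L m w : Set (B1Eq324BenfattoLemma.Site d)) I b,
            Real.exp (psi1p s D κ a L w v m z + psi2 s D κ a L w m z) ∂((gaussianFieldOfKernel (Kb m)).map
              fun (ζ : B1Eq324BenfattoLemma.Site d → ℝ) (x : B1Eq324BenfattoLemma.Site d) => condMean K (corridors L w (J.image (boxIndex L))) ξ x + ζ x)
          ≤ ∫ z in smallFieldOn (shrink L m w : Set (B1Eq324BenfattoLemma.Site d)) I b,
            Real.exp (psiBox s D κ a L w m z) ∂((gaussianFieldOfKernel (Kb m)).map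
              fun (ζ : B1Eq324BenfattoLemma.Site d → ℝ) (x : B1Eq324BenfattoLemma.Site d) => condMean K (corridors L w (J.image (boxIndex L))) ξ x + ζ x)) ∧
      ((cumulantSum (gaussianFieldOfKernel K) (hamiltonian s D κ a J) t - cumulantSum (gaussianFieldOfKernel K) (hamiltonian s D κ a (corridorsBar L w v (J.image (boxIndex L)))) t)
          - (∑ m ∈ (J.image (boxIndex L)), Err m +
            ∑ k ∈ Finset.range t,
          ((2 ^ (k + 1) * (2 ^ ((k + 1) * D) * 2 ^ 2 ^ ((k + 1) * D) * K₀ ^ ((k + 1) * D)) *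
          ((Ac * Real.exp (δ / 2 * ((D : ℝ) ^ 2 * d)) *
              Real.exp (-((κ / 2 - δ / 2 * ((D : ℝ) ^ 2 * Real.sqrt d)) / 2 * w))) * J.card *
            ∑ p ∈ Finset.Icc 1 s, ((admissible p D).card : ℝ) *
              ((2 / (1 - Real.exp (-((κ / 2 - δ / 2 * ((D : ℝ) ^ 2 * Real.sqrt d)) / 2 / (p : ℕ) / Real.sqrt d))) *
                Real.exp ((κ / 2 - δ / 2 * ((D : ℝ) ^ 2 * Real.sqrt d)) / 2 / (p : ℕ) / Real.sqrt d)) ^ d) ^ (p - 1)) *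
          (Ac * Real.exp (δ / 2 * ((D : ℝ) ^ 2 * d)) *
            ((1 : ℝ) * (2 / (1 - Real.exp (-(δ / (2 * ((k + 1 : ℕ) : ℝ)) / Real.sqrt d))) * Real.exp (δ / (2 * ((k + 1 : ℕ) : ℝ)) / Real.sqrt d)) ^ d) *
            ∑ p ∈ Finset.Icc 1 s, ((admissible p D).card : ℝ) *
              ((2 / (1 - Real.exp (-((κ / 2 - δ / 2 * ((D : ℝ) ^ 2 * Real.sqrt d)) / (p : ℕ) / Real.sqrt d))) *
                Real.exp ((κ / 2 - δ / 2 * ((D : ℝ) ^ 2 * Real.sqrt d)) / (p : ℕ) / Real.sqrt d)) ^ d) ^ (p - 1)) ^ k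
          + 2 ^ (k + 1) * (2 ^ ((k + 1) * D) * 2 ^ 2 ^ ((k + 1) * D) * K₀ ^ ((k + 1) * D)) *
        ((J.image (boxIndex L)).card * (Ac * Real.exp (δ / 2 * ((D : ℝ) ^ 2 * d)) * Real.exp (-((κ / 2 - δ / 2 * ((D : ℝ) ^ 2 * Real.sqrt d)) / 2 * v)) *
          (L : ℝ) ^ d * ∑ p ∈ Finset.Icc 1 s, ((admissible p D).card : ℝ) *
              ((2 / (1 - Real.exp (-((κ / 2 - δ / 2 * ((D : ℝ) ^ 2 * Real.sqrt d)) / 2 / (p : ℕ) / Real.sqrt d))) *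
                Real.exp ((κ / 2 - δ / 2 * ((D : ℝ) ^ 2 * Real.sqrt d)) / 2 / (p : ℕ) / Real.sqrt d)) ^ d) ^ (p - 1))) *
        (Ac * Real.exp (δ / 2 * ((D : ℝ) ^ 2 * d)) *
          (2 / (1 - Real.exp (-(δ / (2 * ((k + 1 : ℕ) : ℝ)) / Real.sqrt d))) * Real.exp (δ / (2 * ((k + 1 : ℕ) : ℝ)) / Real.sqrt d)) ^ d *
          ∑ p ∈ Finset.Icc 1 s, ((admissible p D).card : ℝ) *
              ((2 / (1 - Real.exp (-((κ / 2 - δ / 2 * ((D : ℝ) ^ 2 * Real.sqrt d)) / (p : ℕ) / Real.sqrt d))) *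
                Real.exp ((κ / 2 - δ / 2 * ((D : ℝ) ^ 2 * Real.sqrt d)) / (p : ℕ) / Real.sqrt d)) ^ d) ^ (p - 1)) ^ k)
          + (2 ^ (k + 1) * (2 ^ ((k + 1) * D) * 2 ^ 2 ^ ((k + 1) * D) * K₀ ^ ((k + 1) * D)) *
          (Ac * Real.exp (δ / 2 * ((D : ℝ) ^ 2 * d)) * Real.exp (-((κ / 2 - δ / 2 * ((D : ℝ) ^ 2 * Real.sqrt d)) / 2 * w)) *
            (corridorsBar L w v (J.image (boxIndex L))).card * ∑ p ∈ Finset.Icc 1 s, ((admissible p D).card : ℝ) *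
              ((2 / (1 - Real.exp (-((κ / 2 - δ / 2 * ((D : ℝ) ^ 2 * Real.sqrt d)) / 2 / (p : ℕ) / Real.sqrt d))) *
                Real.exp ((κ / 2 - δ / 2 * ((D : ℝ) ^ 2 * Real.sqrt d)) / 2 / (p : ℕ) / Real.sqrt d)) ^ d) ^ (p - 1)) *
          (Ac * Real.exp (δ / 2 * ((D : ℝ) ^ 2 * d)) *
            (2 / (1 - Real.exp (-(δ / (2 * ((k + 1 : ℕ) : ℝ)) / Real.sqrt d))) * Real.exp (δ / (2 * ((k + 1 : ℕ) : ℝ)) / Real.sqrt d)) ^ d *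
            ∑ p ∈ Finset.Icc 1 s, ((admissible p D).card : ℝ) *
              ((2 / (1 - Real.exp (-((κ / 2 - δ / 2 * ((D : ℝ) ^ 2 * Real.sqrt d)) / (p : ℕ) / Real.sqrt d))) *
                Real.exp ((κ / 2 - δ / 2 * ((D : ℝ) ^ 2 * Real.sqrt d)) / (p : ℕ) / Real.sqrt d)) ^ d) ^ (p - 1)) ^ k
          + 2 ^ (k + 1) * (2 ^ ((k + 1) * D) * 2 ^ 2 ^ ((k + 1) * D) * K₀ ^ ((k + 1) * D)) *
        ((J.image (boxIndex L)).card * (Ac * Real.exp (δ / 2 * ((D : ℝ) ^ 2 * d)) * Real.exp (-((κ / 2 - δ / 2 * ((D : ℝ) ^ 2 * Real.sqrt d)) / 2 * v)) *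
          (L : ℝ) ^ d * ∑ p ∈ Finset.Icc 1 s, ((admissible p D).card : ℝ) *
              ((2 / (1 - Real.exp (-((κ / 2 - δ / 2 * ((D : ℝ) ^ 2 * Real.sqrt d)) / 2 / (p : ℕ) / Real.sqrt d))) *
                Real.exp ((κ / 2 - δ / 2 * ((D : ℝ) ^ 2 * Real.sqrt d)) / 2 / (p : ℕ) / Real.sqrt d)) ^ d) ^ (p - 1))) *
        (Ac * Real.exp (δ / 2 * ((D : ℝ) ^ 2 * d)) *
          (2 / (1 - Real.exp (-(δ / (2 * ((k + 1 : ℕ) : ℝ)) / Real.sqrt d))) * Real.exp (δ / (2 * ((k + 1 : ℕ) : ℝ)) / Real.sqrt d)) ^ d *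
          ∑ p ∈ Finset.Icc 1 s, ((admissible p D).card : ℝ) *
              ((2 / (1 - Real.exp (-((κ / 2 - δ / 2 * ((D : ℝ) ^ 2 * Real.sqrt d)) / (p : ℕ) / Real.sqrt d))) *
                Real.exp ((κ / 2 - δ / 2 * ((D : ℝ) ^ 2 * Real.sqrt d)) / (p : ℕ) / Real.sqrt d)) ^ d) ^ (p - 1)) ^ k)
          + 2 ^ ((k + 1) * D) * 2 ^ 2 ^ ((k + 1) * D) * K₀ ^ ((k + 1) * D) *
        ((J.image (boxIndex L)).card * (((k + 1 : ℕ) : ℝ) * (k : ℝ) *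
          ((Ac * Real.exp (δ / 2 * ((D : ℝ) ^ 2 * d)) * ((L : ℝ) ^ d * (2 / (1 - Real.exp (-(δ / (2 * ((k + 1 : ℕ) : ℝ)) / Real.sqrt d))) * Real.exp (δ / (2 * ((k + 1 : ℕ) : ℝ)) / Real.sqrt d)) ^ d) *
              ∑ p ∈ Finset.Icc 1 s, ((admissible p D).card : ℝ) *
              ((2 / (1 - Real.exp (-((κ / 2 - δ / 2 * ((D : ℝ) ^ 2 * Real.sqrt d)) / (p : ℕ) / Real.sqrt d))) *
                Real.exp ((κ / 2 - δ / 2 * ((D : ℝ) ^ 2 * Real.sqrt d)) / (p : ℕ) / Real.sqrt d)) ^ d) ^ (p - 1)) * ((Ac * Real.exp (δ / 2 * ((D : ℝ) ^ 2 * d)) * Real.exp (-(δ / (2 * ((k + 1 : ℕ) : ℝ)) / 2 * ((w : ℝ) + v + 1))) * ((L : ℝ) ^ d * (2 / (1 - Real.exp (-(δ / (2 * ((k + 1 : ℕ) : ℝ)) / 2 / Real.sqrt d))) * Real.exp (δ / (2 * ((k + 1 : ℕ) : ℝ)) / 2 / Real.sqrt d)) ^ d) *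
              ∑ p ∈ Finset.Icc 1 s, ((admissible p D).card : ℝ) *
              ((2 / (1 - Real.exp (-((κ / 2 - δ / 2 * ((D : ℝ) ^ 2 * Real.sqrt d)) / (p : ℕ) / Real.sqrt d))) *
                Real.exp ((κ / 2 - δ / 2 * ((D : ℝ) ^ 2 * Real.sqrt d)) / (p : ℕ) / Real.sqrt d)) ^ d) ^ (p - 1)) *
             (Ac * Real.exp (δ / 2 * ((D : ℝ) ^ 2 * d)) * ((L : ℝ) ^ d * (2 / (1 - Real.exp (-(δ / (2 * ((k + 1 : ℕ) : ℝ)) / Real.sqrt d))) * Real.exp (δ / (2 * ((k + 1 : ℕ) : ℝ)) / Real.sqrt d)) ^ d) *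
              ∑ p ∈ Finset.Icc 1 s, ((admissible p D).card : ℝ) *
              ((2 / (1 - Real.exp (-((κ / 2 - δ / 2 * ((D : ℝ) ^ 2 * Real.sqrt d)) / (p : ℕ) / Real.sqrt d))) *
                Real.exp ((κ / 2 - δ / 2 * ((D : ℝ) ^ 2 * Real.sqrt d)) / (p : ℕ) / Real.sqrt d)) ^ d) ^ (p - 1)) ^ (k - 1)))))
          + (J.image (boxIndex L)).card * ((3 : ℝ) ^ (k + 1) *
        (2 ^ ((k + 1) * D) * 2 ^ 2 ^ ((k + 1) * D) * K₀ ^ ((k + 1) * D) *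
            Real.exp (-(δ / 2 * ((v : ℝ) + 1))) *
          (Ac * Real.exp (δ / 2 * ((D : ℝ) ^ 2 * d)) * (L : ℝ) ^ d * ∑ p ∈ Finset.Icc 1 s, ((admissible p D).card : ℝ) *
              ((2 / (1 - Real.exp (-((κ / 2 - δ / 2 * ((D : ℝ) ^ 2 * Real.sqrt d)) / (p : ℕ) / Real.sqrt d))) *
                Real.exp ((κ / 2 - δ / 2 * ((D : ℝ) ^ 2 * Real.sqrt d)) / (p : ℕ) / Real.sqrt d)) ^ d) ^ (p - 1)) ^ (k + 1)))) / (k + 1)!) ≤ ∑ m ∈ (J.image (boxIndex L)), ℓ m) ∧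
      (∀ m, Err m =
          (2 * (2 ^ ((t + 1).choose 2) * (4 * (s1Const s D d κ * Ac * b ^ D * (L : ℝ) ^ d)) ^ (t + 1) / (t + 1)!) +
                Real.exp (2 * (4 * (s1Const s D d κ * Ac * b ^ D * (L : ℝ) ^ d))) *
                  (3 * (((shrink L m w).card : ℝ) * Real.exp (-(b ^ 2 / 4)))) +
                ∑ k ∈ Finset.range t,
                  (3 ^ (k + 1) * ((∑ π ∈ setPartitions (univ : Finset (Fin (k + 1))), ((π.card - 1)! : ℝ)) *
                      (s1Const s D d κ * Ac * b ^ D * Real.exp (-(κ / 4 * v)) * (L : ℝ) ^ d *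
                        (4 * (s1Const s D d κ * Ac * b ^ D * (L : ℝ) ^ d)) ^ k)) +
                    3 ^ (k + 1) * (2 ^ (k + 1) * ((∑ π ∈ setPartitions (univ : Finset (Fin (k + 1))), ((π.card - 1)! : ℝ)) *
                        ((min 1 (2 * ((shrink L m w).card : ℝ) * Real.exp (-(b ^ 2 / 4)))) ^ ((2 * (k + 1) : ℕ) : ℝ)⁻¹ *
                          ((1 + Ku) ^ D * (Ac * (L : ℝ) ^ d * ∑ p ∈ Finset.Icc 1 s, ((admissible p D).card : ℝ) *
          ((2 / (1 - Real.exp (-(κ / 2 / (p : ℕ) / Real.sqrt d))) * Real.exp (κ / 2 / (p : ℕ) / Real.sqrt d)) ^ d) ^ (p - 1)) * momentConst D (2 * (k + 1)) K₀.toNNReal) ^ (k + 1))) +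
                      2 ^ ((k + 1) * D) * 2 ^ 2 ^ ((k + 1) * D) * K₀ ^ ((k + 1) * D) * Real.exp (-(δ / 2 * ((v : ℝ) + 1))) *
                        (Ac * Real.exp (δ / 2 * ((D : ℝ) ^ 2 * d)) * (L : ℝ) ^ d * ∑ p ∈ Finset.Icc 1 s, ((admissible p D).card : ℝ) *
          ((2 / (1 - Real.exp (-((κ / 2 - δ / 2 * ((D : ℝ) ^ 2 * Real.sqrt d)) / (p : ℕ) / Real.sqrt d))) *
            Real.exp ((κ / 2 - δ / 2 * ((D : ℝ) ^ 2 * Real.sqrt d)) / (p : ℕ) / Real.sqrt d)) ^ d) ^ (p - 1)) ^ (k + 1)) +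
                    3 ^ (k + 1) * (2 ^ (k + 1) * ((∑ π ∈ setPartitions (univ : Finset (Fin (k + 1))), ((π.card - 1)! : ℝ)) *
                        ((min 1 (2 * ((shrink L m w).card : ℝ) * Real.exp (-(b ^ 2 / 4)))) ^ ((2 * (k + 1) : ℕ) : ℝ)⁻¹ *
                          ((1 + Ku) ^ D * (Ac * (L : ℝ) ^ d * ∑ p ∈ Finset.Icc 1 s, ((admissible p D).card : ℝ) *
          ((2 / (1 - Real.exp (-(κ / 2 / (p : ℕ) / Real.sqrt d))) * Real.exp (κ / 2 / (p : ℕ) / Real.sqrt d)) ^ d) ^ (p - 1)) * momentConst D (2 * (k + 1)) K₀.toNNReal) ^ (k + 1))) +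
                      (Ac * (L : ℝ) ^ d * ∑ p ∈ Finset.Icc 1 s, ((admissible p D).card : ℝ) *
          ((2 / (1 - Real.exp (-(κ / 2 / (p : ℕ) / Real.sqrt d))) * Real.exp (κ / 2 / (p : ℕ) / Real.sqrt d)) ^ d) ^ (p - 1)) ^ (k + 1) * (2 ^ ((k + 1) * D) * 2 ^ 2 ^ ((k + 1) * D) *
                        ((((k + 1) * D : ℕ) : ℝ) * K₀ ^ ((k + 1) * D) * ε₃₁)))) / (k + 1)!)) := by
  have hA' : A.PosDef := posDef_of_coercive hAs hγA0 hγA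
  have hKpsd : IsPosSemidefKernel K := isPosSemidefKernel_kernel hK hA'
  have hdiagK : ∀ y, K y y ≤ (K₀.toNNReal : ℝ) := fun y =>
    ((le_abs_self _).trans (hKrR y y)).trans (Real.le_coe_toNNReal K₀)
  have hcJ : ∀ y ∈ J, K y y ≤ (K₀.toNNReal : ℝ) := fun y _ => hdiagK y
  have hL : 0 < L := by omega
  refine ⟨_, fun m =>
          (2 * (2 ^ ((t + 1).choose 2) * (4 * (s1Const s D d κ * Ac * b ^ D * (L : ℝ) ^ d)) ^ (t + 1) / (t + 1)!) +
                Real.exp (2 * (4 * (s1Const s D d κ * Ac * b ^ D * (L : ℝ) ^ d))) *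
                  (3 * (((shrink L m w).card : ℝ) * Real.exp (-(b ^ 2 / 4)))) +
                ∑ k ∈ Finset.range t,
                  (3 ^ (k + 1) * ((∑ π ∈ setPartitions (univ : Finset (Fin (k + 1))), ((π.card - 1)! : ℝ)) *
                      (s1Const s D d κ * Ac * b ^ D * Real.exp (-(κ / 4 * v)) * (L : ℝ) ^ d *
                        (4 * (s1Const s D d κ * Ac * b ^ D * (L : ℝ) ^ d)) ^ k)) +
                    3 ^ (k + 1) * (2 ^ (k + 1) * ((∑ π ∈ setPartitions (univ : Finset (Fin (k + 1))), ((π.card - 1)! : ℝ)) *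
                        ((min 1 (2 * ((shrink L m w).card : ℝ) * Real.exp (-(b ^ 2 / 4)))) ^ ((2 * (k + 1) : ℕ) : ℝ)⁻¹ *
                          ((1 + Ku) ^ D * (Ac * (L : ℝ) ^ d * ∑ p ∈ Finset.Icc 1 s, ((admissible p D).card : ℝ) *
          ((2 / (1 - Real.exp (-(κ / 2 / (p : ℕ) / Real.sqrt d))) * Real.exp (κ / 2 / (p : ℕ) / Real.sqrt d)) ^ d) ^ (p - 1)) * momentConst D (2 * (k + 1)) K₀.toNNReal) ^ (k + 1))) +
                      2 ^ ((k + 1) * D) * 2 ^ 2 ^ ((k + 1) * D) * K₀ ^ ((k + 1) * D) * Real.exp (-(δ / 2 * ((v : ℝ) + 1))) *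
                        (Ac * Real.exp (δ / 2 * ((D : ℝ) ^ 2 * d)) * (L : ℝ) ^ d * ∑ p ∈ Finset.Icc 1 s, ((admissible p D).card : ℝ) *
          ((2 / (1 - Real.exp (-((κ / 2 - δ / 2 * ((D : ℝ) ^ 2 * Real.sqrt d)) / (p : ℕ) / Real.sqrt d))) *
            Real.exp ((κ / 2 - δ / 2 * ((D : ℝ) ^ 2 * Real.sqrt d)) / (p : ℕ) / Real.sqrt d)) ^ d) ^ (p - 1)) ^ (k + 1)) +
                    3 ^ (k + 1) * (2 ^ (k + 1) * ((∑ π ∈ setPartitions (univ : Finset (Fin (k + 1))), ((π.card - 1)! : ℝ)) *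
                        ((min 1 (2 * ((shrink L m w).card : ℝ) * Real.exp (-(b ^ 2 / 4)))) ^ ((2 * (k + 1) : ℕ) : ℝ)⁻¹ *
                          ((1 + Ku) ^ D * (Ac * (L : ℝ) ^ d * ∑ p ∈ Finset.Icc 1 s, ((admissible p D).card : ℝ) *
          ((2 / (1 - Real.exp (-(κ / 2 / (p : ℕ) / Real.sqrt d))) * Real.exp (κ / 2 / (p : ℕ) / Real.sqrt d)) ^ d) ^ (p - 1)) * momentConst D (2 * (k + 1)) K₀.toNNReal) ^ (k + 1))) +
                      (Ac * (L : ℝ) ^ d * ∑ p ∈ Finset.Icc 1 s, ((admissible p D).card : ℝ) *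
          ((2 / (1 - Real.exp (-(κ / 2 / (p : ℕ) / Real.sqrt d))) * Real.exp (κ / 2 / (p : ℕ) / Real.sqrt d)) ^ d) ^ (p - 1)) ^ (k + 1) * (2 ^ ((k + 1) * D) * 2 ^ 2 ^ ((k + 1) * D) *
                        ((((k + 1) * D : ℕ) : ℝ) * K₀ ^ ((k + 1) * D) * ε₃₁)))) / (k + 1)!),
    hbox_of_clusterRows hK hAs hγA0 hγA hL hΓΛ hBΛ hKb hκ hJ hJI hAc0 hA hv hb hγ1 hKu hKuK hK₀1 hε₃₁ huI hKR hKrR hdec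
      huε hKε hvar hm (fun m _ => card_shrink_mul_exp_le hsmall)
      (fun m => ![fun p => tuplesIn J p (frame4 L w v m) ∪ crossT J p (frame4 L w v m) (frame3 L w v m),
        fun p => (tuplesIn J p (core L w m) \ tuplesIn J p (frame4 L w v m)) ∪
          (crossT J p (core L w m) (frame3 L w v m) \ crossT J p (frame4 L w v m) (frame3 L w v m)),
        fun p => crossT J p (frame1 L w m) (frame2 L w m) ∪ tuplesIn J p (frame2 L w m)])
      (fun m p => rfl) (fun m p => rfl) (fun m p => rfl)
      (fun m c => mass_classes_le (s := s) (D := D) (κ := κ) (J := J) (L := L) (w := w) (v := v) (m := m) hκ hAc0 hA hv c) hδ.le hδle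
      (fun m c => weightedMass_classes_le (s := s) (D := D) (κ := κ) (J := J) (L := L) (w := w) (v := v) (m := m) hAc0 hres hA hv c) t,
    ?_, fun m => rfl⟩
  have hid := Literature.MathematicalPhysics.QuantumFieldTheory.Balaban1983to89.B1Eq324BenfattoKernelSect5Identification.identification_lower
    (s := s) (D := D) (κ := κ) (L := L) (w := w) (v := v) (B := (J.image (boxIndex L))) hKpsd hcJ hJ
    (fun (c : Option (↥(J.image (boxIndex L)) × Bool)) (z : B1Eq324BenfattoLemma.Site d → ℝ) =>
        Option.elim c (hamiltonian s D κ a (corridors L w (J.image (boxIndex L))) z)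
          (fun mb => bif mb.2 then psi1pp s D κ a L w v (mb.1 : B1Eq324BenfattoLemma.Site d) z
            else psi1p s D κ a L w v (mb.1 : B1Eq324BenfattoLemma.Site d) z + psi2 s D κ a L w (mb.1 : B1Eq324BenfattoLemma.Site d) z))
    rfl (fun _ => rfl) (fun _ => rfl) t (fun m =>
          (2 * (2 ^ ((t + 1).choose 2) * (4 * (s1Const s D d κ * Ac * b ^ D * (L : ℝ) ^ d)) ^ (t + 1) / (t + 1)!) +
                Real.exp (2 * (4 * (s1Const s D d κ * Ac * b ^ D * (L : ℝ) ^ d))) *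
                  (3 * (((shrink L m w).card : ℝ) * Real.exp (-(b ^ 2 / 4)))) +
                ∑ k ∈ Finset.range t,
                  (3 ^ (k + 1) * ((∑ π ∈ setPartitions (univ : Finset (Fin (k + 1))), ((π.card - 1)! : ℝ)) *
                      (s1Const s D d κ * Ac * b ^ D * Real.exp (-(κ / 4 * v)) * (L : ℝ) ^ d *
                        (4 * (s1Const s D d κ * Ac * b ^ D * (L : ℝ) ^ d)) ^ k)) +
                    3 ^ (k + 1) * (2 ^ (k + 1) * ((∑ π ∈ setPartitions (univ : Finset (Fin (k + 1))), ((π.card - 1)! : ℝ)) *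
                        ((min 1 (2 * ((shrink L m w).card : ℝ) * Real.exp (-(b ^ 2 / 4)))) ^ ((2 * (k + 1) : ℕ) : ℝ)⁻¹ *
                          ((1 + Ku) ^ D * (Ac * (L : ℝ) ^ d * ∑ p ∈ Finset.Icc 1 s, ((admissible p D).card : ℝ) *
          ((2 / (1 - Real.exp (-(κ / 2 / (p : ℕ) / Real.sqrt d))) * Real.exp (κ / 2 / (p : ℕ) / Real.sqrt d)) ^ d) ^ (p - 1)) * momentConst D (2 * (k + 1)) K₀.toNNReal) ^ (k + 1))) +
                      2 ^ ((k + 1) * D) * 2 ^ 2 ^ ((k + 1) * D) * K₀ ^ ((k + 1) * D) * Real.exp (-(δ / 2 * ((v : ℝ) + 1))) *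
                        (Ac * Real.exp (δ / 2 * ((D : ℝ) ^ 2 * d)) * (L : ℝ) ^ d * ∑ p ∈ Finset.Icc 1 s, ((admissible p D).card : ℝ) *
          ((2 / (1 - Real.exp (-((κ / 2 - δ / 2 * ((D : ℝ) ^ 2 * Real.sqrt d)) / (p : ℕ) / Real.sqrt d))) *
            Real.exp ((κ / 2 - δ / 2 * ((D : ℝ) ^ 2 * Real.sqrt d)) / (p : ℕ) / Real.sqrt d)) ^ d) ^ (p - 1)) ^ (k + 1)) +
                    3 ^ (k + 1) * (2 ^ (k + 1) * ((∑ π ∈ setPartitions (univ : Finset (Fin (k + 1))), ((π.card - 1)! : ℝ)) *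
                        ((min 1 (2 * ((shrink L m w).card : ℝ) * Real.exp (-(b ^ 2 / 4)))) ^ ((2 * (k + 1) : ℕ) : ℝ)⁻¹ *
                          ((1 + Ku) ^ D * (Ac * (L : ℝ) ^ d * ∑ p ∈ Finset.Icc 1 s, ((admissible p D).card : ℝ) *
          ((2 / (1 - Real.exp (-(κ / 2 / (p : ℕ) / Real.sqrt d))) * Real.exp (κ / 2 / (p : ℕ) / Real.sqrt d)) ^ d) ^ (p - 1)) * momentConst D (2 * (k + 1)) K₀.toNNReal) ^ (k + 1))) +
                      (Ac * (L : ℝ) ^ d * ∑ p ∈ Finset.Icc 1 s, ((admissible p D).card : ℝ) *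
          ((2 / (1 - Real.exp (-(κ / 2 / (p : ℕ) / Real.sqrt d))) * Real.exp (κ / 2 / (p : ℕ) / Real.sqrt d)) ^ d) ^ (p - 1)) ^ (k + 1) * (2 ^ ((k + 1) * D) * 2 ^ 2 ^ ((k + 1) * D) *
                        ((((k + 1) * D : ℕ) : ℝ) * K₀ ^ ((k + 1) * D) * ε₃₁)))) / (k + 1)!))
  have hcs := cumulantSide_le (s := s) (D := D) (κ := κ) (J := J) (L := L) (w := w) (v := v) hKpsd hdiagK hK₀1 hKdec hJ hAc0 hA hL
    hL2 hv hδ hδle hres t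
  refine le_trans ?_ (le_of_eq (Finset.sum_congr rfl fun m _ => rfl) |>.trans' hid)
  linarith

end Step

end Literature.MathematicalPhysics.QuantumFieldTheory.Balaban1983to89.B1Eq324BenfattoKernelSect5StepBound

end
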